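import Summits.AnomalousDissipation.AnomalousDissipation.Theorems.SteadyWeakLimitStandingCascadeExistsIteration
import Literature.Analysis.FluidPDE.StationaryEulerLimit
import Literature.Analysis.FluidPDE.ConvexIntegration2DIteration
import HarnessLib

/-!
# Route SteadyWeakLimit — support `StandingCascadeExists`: energies and the a.e. limit of the forced iteration

Helper file for the item `stmt-AnomalousDissipation-1309` (`StandingCascadeExists`), continuing
`SteadyWeakLimitStandingCascadeExistsIteration.lean` (the forced run `FIterData` of the
Choffrut–Székelyhidi iteration). Verbatim the second half of the tree's
`Literature/Analysis/FluidPDE/StationaryEulerIteration.lean` and the first half of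
`StationaryEulerLimit.lean` for the affine space `X₀`:

* energies `E_k = ‖w_k‖²_{L²}`, corrected energies `F_k = E_k + 2 Σ_{i<k} ε_i` (monotone,
  bounded), `‖w_m - w_n‖²_{L²} ≤ F_m - F_n` and the `L²` Cauchy property (`cauchy`); summable
  defects `Σ_k J(w_k) ≤ R² + 3θ`, hence `J(w_k) → 0` (`tendsto_J`);
* along an `L²`-fast subsequence the states converge a.e. (`wlim`) to a bounded limit with values
  in `𝒦^{co}_{e(x)}` a.e., and the vanishing of the defect puts the limit in `𝒦_{e(x)}` a.e.:
  `u = v ⊗ v - e/d Id`, `|v|² = e` (`ae_wlim_mem_K`).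

The affine identities and the test-field pairing pass to the limit in
`SteadyWeakLimitStandingCascadeExists.lean`.

## References

* A. Choffrut, L. Székelyhidi Jr., SIAM J. Math. Anal. 46 (2014) = arXiv:1401.4301, §2, Step 3.
* L. Székelyhidi Jr., *From isometric embeddings to turbulence*, Lecture notes (2012), §5–6.
* A. Choffrut, L. Székelyhidi Jr., loc. cit., §2 Step 3 and Lemma 2 (the limit).
-/

noncomputable section

open scoped InnerProductSpace ContDiff ENNReal Topology
open Set Function MeasureTheory Metric Filter
open Literature.Analysis.FunctionSpaces Literature.Analysis.FluidPDE
open Literature.Analysis.FluidPDE.StationaryEuler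

namespace Summit.AnomalousDissipation.AnomalousDissipation.Theorems

-- the mandated namespace `Summit.<Summit>.<Problem>.Theorems` repeats `AnomalousDissipation` (single-problem summit)
set_option linter.dupNamespace false

namespace StandingCascade

variable {d : Type*} [Fintype d] [DecidableEq d] [Nonempty d]

namespace FIterData

variable (D : FIterData d)

-- the `L²` pairing `ip u v = ∫ ⟪u, v⟫` and its elementary properties are the tree's (they do not depend on a run)
open Literature.Analysis.FluidPDE.StationaryEuler.IterData (ip ip_comm ip_self ip_self_nonneg)

/-- The energy `E_k = ‖w_k‖²_{L²}`. [folklore] -/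
def E (k : ℕ) : ℝ := ip (D.state k) (D.state k)

/-- `E_{k+1} = E_k + 2⟨w_k, W_k⟩ + ‖W_k‖²`. [folklore] -/
theorem E_succ (k : ℕ) : D.E (k + 1) = D.E k + 2 * ip (D.state k) (D.incr k) + ip (D.incr k) (D.incr k) := by
  simp only [E, ip]
  have h1 : Integrable fun x => ⟪D.state k x, D.state k x⟫_ℝ := ((D.state_continuous k).inner (D.state_continuous k)).integrable_unitAddTorus
  have h2 : Integrable fun x => ⟪D.state k x, D.incr k x⟫_ℝ := ((D.state_continuous k).inner (D.incr_continuous k)).integrable_unitAddTorus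
  have h3 : Integrable fun x => ⟪D.incr k x, D.incr k x⟫_ℝ := ((D.incr_continuous k).inner (D.incr_continuous k)).integrable_unitAddTorus
  have : (fun x => ⟪D.state (k + 1) x, D.state (k + 1) x⟫_ℝ) =
      fun x => ⟪D.state k x, D.state k x⟫_ℝ + 2 * ⟪D.state k x, D.incr k x⟫_ℝ + ⟪D.incr k x, D.incr k x⟫_ℝ := by
    funext x
    rw [D.state_succ_apply, inner_add_left, inner_add_right, inner_add_right, real_inner_comm (D.incr k x) (D.state k x)]
    ring
  have h12 : Integrable fun x => ⟪D.state k x, D.state k x⟫_ℝ + 2 * ⟪D.state k x, D.incr k x⟫_ℝ := h1.add (h2.const_mul 2)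
  rw [this, integral_add h12 h3, integral_add h1 (h2.const_mul 2), integral_const_mul]

/-- `|⟨W_k, w_j⟩| ≤ ε_k` for `j ≤ k`. [folklore] -/
theorem abs_ip_incr_state_le {k j : ℕ} (hj : j ≤ k) : |ip (D.incr k) (D.state j)| ≤ D.eps k := D.incr_orth_state hj

/-- The energies are bounded: `E_k ≤ R²`. [folklore] -/
theorem E_le (k : ℕ) : D.E k ≤ D.R ^ 2 := by
  rw [E, ip_self]
  calc ∫ x, ‖D.state k x‖ ^ 2 ≤ ∫ _ : UnitAddTorus d, D.R ^ 2 := by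
        refine integral_mono ((D.state_continuous k).norm.pow 2).integrable_unitAddTorus (integrable_const _) fun x => ?_
        exact pow_le_pow_left₀ (norm_nonneg _) (D.norm_state_le k x) 2
    _ = D.R ^ 2 := by simp

/-- The corrected energies `F_k = E_k + 2 Σ_{i<k} ε_i`. [folklore] -/
def F (k : ℕ) : ℝ := D.E k + 2 * ∑ i ∈ Finset.range k, D.eps i

/-- The corrected energies are non-decreasing. [folklore] -/
theorem F_monotone : Monotone D.F := by
  refine monotone_nat_of_le_succ fun k => ?_
  simp only [F, Finset.sum_range_succ, D.E_succ]
  have h1 := D.abs_ip_incr_state_le (le_refl k)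
  rw [ip_comm] at h1
  have h2 := ip_self_nonneg (D.incr k)
  have := neg_abs_le (ip (D.state k) (D.incr k))
  linarith

/-- The corrected energies are bounded. [folklore] -/
theorem F_le (k : ℕ) : D.F k ≤ D.R ^ 2 + 2 * D.θ := by
  unfold F; linarith [D.E_le k, D.sum_eps_le (Finset.range k)]

/-- **`‖w_m - w_n‖²_{L²} ≤ F_m - F_n` for `n ≤ m`.** [folklore] -/
theorem ip_sub_le (n m : ℕ) (hnm : n ≤ m) :
    ip (fun x => D.state m x - D.state n x) (fun x => D.state m x - D.state n x) ≤ D.F m - D.F n := by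
  have key : ∀ j : ℕ, ip (fun x => D.state (n + j) x - D.state n x) (fun x => D.state (n + j) x - D.state n x) =
      D.E (n + j) - D.E n - 2 * ∑ k ∈ Finset.range j, ip (D.incr (n + k)) (D.state n) := by
    intro j
    induction j with
    | zero => simp [ip, E]
    | succ j ih =>
      rw [Finset.sum_range_succ, ← add_assoc, D.E_succ (n + j)]
      have hX : ip (fun x => D.state (n + j + 1) x - D.state n x) (fun x => D.state (n + j + 1) x - D.state n x) =
          ip (fun x => D.state (n + j) x - D.state n x) (fun x => D.state (n + j) x - D.state n x) +
            2 * (ip (D.state (n + j)) (D.incr (n + j)) - ip (D.incr (n + j)) (D.state n)) +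
            ip (D.incr (n + j)) (D.incr (n + j)) := by
        simp only [ip]
        set W := D.incr (n + j)
        set a := D.state (n + j)
        set b := D.state n
        have hW : Continuous W := D.incr_continuous _
        have ha : Continuous a := D.state_continuous _
        have hb : Continuous b := D.state_continuous _
        have i1 : Integrable fun x => ⟪a x - b x, a x - b x⟫_ℝ := ((ha.sub hb).inner (ha.sub hb)).integrable_unitAddTorus
        have i2 : Integrable fun x => ⟪a x, W x⟫_ℝ := (ha.inner hW).integrable_unitAddTorus
        have i3 : Integrable fun x => ⟪W x, b x⟫_ℝ := (hW.inner hb).integrable_unitAddTorus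
        have i4 : Integrable fun x => ⟪W x, W x⟫_ℝ := (hW.inner hW).integrable_unitAddTorus
        have : (fun x => ⟪D.state (n + j + 1) x - b x, D.state (n + j + 1) x - b x⟫_ℝ) =
            fun x => ⟪a x - b x, a x - b x⟫_ℝ + 2 * (⟪a x, W x⟫_ℝ - ⟪W x, b x⟫_ℝ) + ⟪W x, W x⟫_ℝ := by
          funext x
          have hs : D.state (n + j + 1) x = a x + W x := D.state_succ_apply (n + j) x
          rw [hs]
          simp only [inner_add_left, inner_add_right, inner_sub_left, inner_sub_right, real_inner_comm (W x) (a x),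
            real_inner_comm (b x) (W x), real_inner_comm (b x) (a x)]
          ring
        have i23 : Integrable fun x => 2 * (⟪a x, W x⟫_ℝ - ⟪W x, b x⟫_ℝ) := (i2.sub i3).const_mul 2
        have i123 : Integrable fun x => ⟪a x - b x, a x - b x⟫_ℝ + 2 * (⟪a x, W x⟫_ℝ - ⟪W x, b x⟫_ℝ) := i1.add i23
        rw [this, integral_add i123 i4, integral_add i1 i23, integral_const_mul, integral_sub i2 i3]
      rw [hX, ih]
      ring
  obtain ⟨j, rfl⟩ := Nat.exists_eq_add_of_le hnm
  rw [key j]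
  simp only [F, Finset.sum_range_add]
  have hb : ∀ k ∈ Finset.range j, -ip (D.incr (n + k)) (D.state n) ≤ D.eps (n + k) :=
    fun k _ => (neg_le_abs _).trans (D.abs_ip_incr_state_le (Nat.le_add_right n k))
  have hs := Finset.sum_le_sum hb
  rw [Finset.sum_neg_distrib] at hs
  linarith

/-- **The states form a Cauchy sequence in `L²`** (monotone bounded corrected energies, as in the
tree's `ConvexIntegration.exists_forall_sub_lt_of_monotone`). [cite: ChoffrutSzekelyhidi2014, §2, Step 3] -/
theorem cauchy {η : ℝ} (hη : 0 < η) :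
    ∃ M : ℕ, ∀ n m, M ≤ n → n ≤ m → ∫ x, ‖D.state m x - D.state n x‖ ^ 2 < η := by
  obtain ⟨M, hM⟩ := ConvexIntegration.exists_forall_sub_lt_of_monotone D.F_monotone D.F_le hη
  refine ⟨M, fun n m hn hnm => ?_⟩
  have h := (D.ip_sub_le n m hnm).trans_lt (hM n m hn hnm)
  rwa [ip_self] at h

/-! ## The defects tend to zero -/

/-- The defect `J_k = ∫ (e - |v_k|²)` of the `k`-th state. [folklore] -/
def J (k : ℕ) : ℝ := defect D.e (D.state k)

/-- `J_k ≥ 0`. [folklore] -/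
theorem J_nonneg (k : ℕ) : 0 ≤ D.J k := (D.state_memX k).defect_nonneg

/-- `J_k ≤ E_{k+1} - E_k + 3 ε_k`. [folklore] -/
theorem J_le (k : ℕ) : D.J k ≤ D.E (k + 1) - D.E k + 3 * D.eps k := by
  rw [D.E_succ]
  have h1 := D.abs_ip_incr_state_le (le_refl k)
  rw [ip_comm] at h1
  have h2 := D.incr_gain k
  rw [← ip_self] at h2
  have := neg_abs_le (ip (D.state k) (D.incr k))
  unfold J; linarith

/-- **The defects are summable**: `Σ_{k<n} J_k ≤ R² + 3θ`. [cite: ChoffrutSzekelyhidi2014, §2, Step 3] -/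
theorem sum_J_le (n : ℕ) : ∑ k ∈ Finset.range n, D.J k ≤ D.R ^ 2 + 3 * D.θ := by
  have h1 : ∑ k ∈ Finset.range n, D.J k ≤ ∑ k ∈ Finset.range n, (D.E (k + 1) - D.E k + 3 * D.eps k) :=
    Finset.sum_le_sum fun k _ => D.J_le k
  rw [Finset.sum_add_distrib, Finset.sum_range_sub, ← Finset.mul_sum] at h1
  have h2 := D.E_le n
  have h3 : 0 ≤ D.E 0 := ip_self_nonneg _
  linarith [D.sum_eps_le (Finset.range n)]

/-- The defects are summable. [folklore] -/
theorem summable_J : Summable D.J :=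
  summable_of_sum_range_le D.J_nonneg D.sum_J_le

/-- **The defects tend to zero.** [cite: ChoffrutSzekelyhidi2014, §2, Step 3] -/
theorem tendsto_J : Tendsto D.J atTop (𝓝 0) := D.summable_J.tendsto_atTop_zero

/-! ## An `L²`-fast subsequence -/

/-- Thresholds of the Cauchy property at level `4^{-i}`. [folklore] -/
def thr (i : ℕ) : ℕ := Classical.choose (D.cauchy (η := (1 / 4) ^ i) (by positivity))

/-- The defining property of the thresholds. [folklore] -/
theorem thr_spec (i : ℕ) : ∀ n m, D.thr i ≤ n → n ≤ m → ∫ x, ‖D.state m x - D.state n x‖ ^ 2 < (1 / 4) ^ i :=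
  Classical.choose_spec (D.cauchy (η := (1 / 4) ^ i) (by positivity))

/-- The subsequence: strictly increasing and above the thresholds. [folklore] -/
def sub : ℕ → ℕ
  | 0 => D.thr 0
  | i + 1 => max (sub i + 1) (D.thr (i + 1))

/-- The subsequence dominates the thresholds. [folklore] -/
theorem thr_le_sub (i : ℕ) : D.thr i ≤ D.sub i := by
  cases i with
  | zero => exact le_rfl
  | succ i => exact le_max_right _ _

/-- The subsequence is strictly increasing. [folklore] -/
theorem sub_lt_sub_succ (i : ℕ) : D.sub i < D.sub (i + 1) :=
  Nat.lt_of_lt_of_le (Nat.lt_succ_self _) (le_max_left _ _)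

/-- The subsequence is strictly monotone. [folklore] -/
theorem sub_strictMono : StrictMono D.sub := strictMono_nat_of_lt_succ D.sub_lt_sub_succ

/-- Fast `L²` convergence along the subsequence: `‖w_{φ(j)} - w_{φ(i)}‖² < 4^{-i}` for `i ≤ j`. [folklore] -/
theorem integral_sq_sub_lt {i j : ℕ} (hij : i ≤ j) :
    ∫ x, ‖D.state (D.sub j) x - D.state (D.sub i) x‖ ^ 2 < (1 / 4) ^ i :=
  D.thr_spec i _ _ (D.thr_le_sub i) (D.sub_strictMono.monotone hij)

/-- `L¹` control of consecutive terms: `∫ ‖w_{φ(i+1)} - w_{φ(i)}‖ ≤ 2^{-i}` (from `L²` via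
`|x| ≤ (t x² + t⁻¹)/2` with `t = 2^i` on the probability space). [folklore] -/
theorem integral_norm_sub_le (i : ℕ) :
    ∫ x, ‖D.state (D.sub (i + 1)) x - D.state (D.sub i) x‖ ≤ (1 / 2) ^ i := by
  set G : UnitAddTorus d → State d := fun x => D.state (D.sub (i + 1)) x - D.state (D.sub i) x with hG
  have hGc : Continuous G := (D.state_continuous _).sub (D.state_continuous _)
  have ht : (0 : ℝ) < 2 ^ i := by positivity
  have hpt : ∀ x, ‖G x‖ ≤ (2 ^ i * ‖G x‖ ^ 2 + (2 ^ i)⁻¹) / 2 := fun x => by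
    have h := sq_nonneg (2 ^ i * ‖G x‖ - 1)
    have h2 : (2 : ℝ) ^ i * (2 ^ i)⁻¹ = 1 := mul_inv_cancel₀ ht.ne'
    nlinarith [norm_nonneg (G x), h2, inv_pos.2 ht]
  have hI2 : Integrable fun x => ‖G x‖ ^ 2 := (hGc.norm.pow 2).integrable_unitAddTorus
  calc ∫ x, ‖G x‖ ≤ ∫ x, (2 ^ i * ‖G x‖ ^ 2 + (2 ^ i)⁻¹) / 2 :=
        integral_mono hGc.norm.integrable_unitAddTorus (((hI2.const_mul _).add (integrable_const _)).div_const _) hpt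
    _ = (2 ^ i * (∫ x, ‖G x‖ ^ 2) + (2 ^ i)⁻¹) / 2 := by
        rw [integral_div, integral_add (hI2.const_mul _) (integrable_const _), integral_const_mul]
        simp
    _ ≤ (2 ^ i * (1 / 4) ^ i + (2 ^ i)⁻¹) / 2 := by
        have h := (D.integral_sq_sub_lt (Nat.le_succ i)).le
        have h' : (∫ x, ‖G x‖ ^ 2) ≤ (1 / 4) ^ i := h
        gcongr
    _ = (1 / 2) ^ i := by
        have h1 : (2 : ℝ) ^ i * (1 / 4) ^ i = (1 / 2) ^ i := by rw [← mul_pow]; norm_num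
        have h2 : ((2 : ℝ) ^ i)⁻¹ = (1 / 2) ^ i := by rw [← inv_pow]; norm_num
        rw [h1, h2]; ring

/-! ## Almost everywhere convergence -/

/-- **Almost everywhere convergence along the subsequence** (summable `L¹` increments).
[folklore] -/
theorem ae_exists_tendsto : ∀ᵐ x, ∃ l : State d, Tendsto (fun i => D.state (D.sub i) x) atTop (𝓝 l) := by
  set G : ℕ → UnitAddTorus d → State d := fun i x => D.state (D.sub i) x with hG
  have hGc : ∀ i, Continuous (G i) := fun i => D.state_continuous _
  have hmeas : ∀ i, AEMeasurable (fun x => ‖G (i + 1) x - G i x‖ₑ) volume := fun i =>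
    (((hGc (i + 1)).sub (hGc i)).measurable.enorm).aemeasurable
  have h1 : ∫⁻ x, ∑' i, ‖G (i + 1) x - G i x‖ₑ = ∑' i, ∫⁻ x, ‖G (i + 1) x - G i x‖ₑ := lintegral_tsum hmeas
  have h2 : ∀ i, ∫⁻ x, ‖G (i + 1) x - G i x‖ₑ ≤ ENNReal.ofReal ((1 / 2) ^ i) := by
    intro i
    have hint : Integrable (fun x => G (i + 1) x - G i x) := ((hGc (i + 1)).sub (hGc i)).integrable_unitAddTorus
    rw [← ofReal_integral_norm_eq_lintegral_enorm hint]
    exact ENNReal.ofReal_le_ofReal (D.integral_norm_sub_le i)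
  have hgeo : Summable fun i : ℕ => ((1 : ℝ) / 2) ^ i := summable_geometric_of_lt_one (by norm_num) (by norm_num)
  have h3 : ∫⁻ x, ∑' i, ‖G (i + 1) x - G i x‖ₑ < ⊤ := by
    rw [h1]
    calc ∑' i, ∫⁻ x, ‖G (i + 1) x - G i x‖ₑ ≤ ∑' i, ENNReal.ofReal ((1 / 2) ^ i) := ENNReal.tsum_le_tsum h2
      _ = ENNReal.ofReal (∑' i, ((1 : ℝ) / 2) ^ i) := (ENNReal.ofReal_tsum_of_nonneg (fun i => by positivity) hgeo).symm
      _ < ⊤ := ENNReal.ofReal_lt_top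
  have hmeas' : Measurable fun x => ∑' i, ‖G (i + 1) x - G i x‖ₑ := by
    simp_rw [ENNReal.tsum_eq_iSup_sum]
    exact .iSup fun s => s.measurable_fun_sum fun i _ => ((hGc (i + 1)).sub (hGc i)).measurable.enorm
  have h4 : ∀ᵐ x, ∑' i, ‖G (i + 1) x - G i x‖ₑ < ⊤ := ae_lt_top hmeas' h3.ne
  filter_upwards [h4] with x hx
  have hsum : Summable fun i => G (i + 1) x - G i x := .of_nnnorm <| ENNReal.tsum_coe_ne_top_iff_summable.mp hx.ne
  have hx_sum := hsum.hasSum.tendsto_sum_nat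
  rw [funext fun n => Finset.sum_range_sub (fun m => G m x) n] at hx_sum
  exact ⟨∑' i, (G (i + 1) x - G i x) + G 0 x, by simpa using hx_sum.add_const (G 0 x)⟩

/-- **The limit state** `w = lim w_{φ(i)}` (a.e.; junk elsewhere). [cite: ChoffrutSzekelyhidi2014, §2, Step 3] -/
def wlim (x : UnitAddTorus d) : State d := limUnder atTop fun i => D.state (D.sub i) x

/-- The states converge to the limit state a.e. [folklore] -/
theorem ae_tendsto_wlim : ∀ᵐ x, Tendsto (fun i => D.state (D.sub i) x) atTop (𝓝 (D.wlim x)) := by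
  filter_upwards [D.ae_exists_tendsto] with x hx
  exact tendsto_nhds_limUnder hx

/-- The limit state is a.e.-strongly measurable. [folklore] -/
theorem aestronglyMeasurable_wlim : AEStronglyMeasurable D.wlim volume :=
  aestronglyMeasurable_of_tendsto_ae atTop (fun i => (D.state_continuous (D.sub i)).aestronglyMeasurable) D.ae_tendsto_wlim

/-- **The limit is bounded by `R`** a.e. [folklore] -/
theorem ae_norm_wlim_le : ∀ᵐ x, ‖D.wlim x‖ ≤ D.R := by
  filter_upwards [D.ae_tendsto_wlim] with x hx
  exact isClosed_Iic.mem_of_tendsto ((continuous_norm.tendsto _).comp hx) (Eventually.of_forall fun i => D.norm_state_le _ x)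

/-- **The limit takes values in `𝒦^{co}_{e(x)}`** a.e. (closedness). [cite: ChoffrutSzekelyhidi2014, §2, Step 3] -/
theorem ae_wlim_mem_C : ∀ᵐ x, D.wlim x ∈ C (D.e x) := by
  filter_upwards [D.ae_tendsto_wlim] with x hx
  have h := isClosed_setOf_mem_C (d := d) |>.mem_of_tendsto ((tendsto_const_nhds (x := D.e x)).prodMk_nhds hx)
    (Eventually.of_forall fun i => (D.state_memX (D.sub i)).mem_C x)
  exact h

/-- The limit is admissible a.e. [folklore] -/
theorem ae_isAdm_wlim : ∀ᵐ x, IsAdm (D.wlim x) := by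
  filter_upwards [D.ae_wlim_mem_C] with x hx using hx.1

/-! ## The defect vanishes in the limit -/

/-- **`|v|² = e` a.e. for the limit**: the defects `J(w_{φ(i)}) → 0` and dominated convergence.
[cite: ChoffrutSzekelyhidi2014, §2, Step 3] -/
theorem ae_norm_vel_wlim_sq : ∀ᵐ x, ‖vel (D.wlim x)‖ ^ 2 = D.e x := by
  set g : ℕ → UnitAddTorus d → ℝ := fun i x => D.e x - ‖vel (D.state (D.sub i) x)‖ ^ 2 with hg
  set gl : UnitAddTorus d → ℝ := fun x => D.e x - ‖vel (D.wlim x)‖ ^ 2 with hgl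
  have hgc : ∀ i, Continuous (g i) := fun i =>
    D.he.sub ((continuous_norm.comp (continuous_vel.comp (D.state_continuous _))).pow 2)
  -- dominated convergence: `∫ g i → ∫ gl`
  have hbound : ∀ i, ∀ᵐ x, ‖g i x‖ ≤ D.ebar + D.R ^ 2 := fun i => Eventually.of_forall fun x => by
    rw [Real.norm_eq_abs, abs_le]
    have h1 := (D.state_memX (D.sub i)).norm_vel_sq_le x
    have h2 := (D.state_memX (D.sub i)).nonneg x
    have h3 := D.e_le_ebar x
    have h4 : ‖vel (D.state (D.sub i) x)‖ ^ 2 ≤ D.R ^ 2 :=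
      pow_le_pow_left₀ (norm_nonneg _) ((norm_vel_le _).trans (D.norm_state_le _ x)) 2
    constructor <;> simp only [hg] <;> nlinarith [sq_nonneg D.R]
  have hlim : ∀ᵐ x, Tendsto (fun i => g i x) atTop (𝓝 (gl x)) := by
    filter_upwards [D.ae_tendsto_wlim] with x hx
    exact tendsto_const_nhds.sub (((continuous_norm.comp continuous_vel).tendsto _).comp hx |>.pow 2)
  have hT := tendsto_integral_of_dominated_convergence (fun _ => D.ebar + D.R ^ 2)
    (fun i => (hgc i).aestronglyMeasurable) (integrable_const _) hbound hlim
  -- but `∫ g i = J (φ i) → 0`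
  have hJ : Tendsto (fun i => ∫ x, g i x) atTop (𝓝 0) := by
    have := D.tendsto_J.comp D.sub_strictMono.tendsto_atTop
    exact this
  have h0 : ∫ x, gl x = 0 := tendsto_nhds_unique hT hJ
  -- `gl ≥ 0` a.e. and integrable
  have hgl0 : 0 ≤ᵐ[volume] gl := by
    filter_upwards [D.ae_wlim_mem_C] with x hx
    exact sub_nonneg.2 (norm_vel_sq_le_of_mem_C hx)
  have hgli : Integrable gl := by
    refine Integrable.mono' (integrable_const (D.ebar + D.R ^ 2)) ?_ ?_
    · exact aestronglyMeasurable_of_tendsto_ae atTop (fun i => (hgc i).aestronglyMeasurable) hlim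
    · filter_upwards [D.ae_norm_wlim_le, D.ae_wlim_mem_C] with x hx hC
      rw [Real.norm_eq_abs, abs_le]
      have h1 := norm_vel_sq_le_of_mem_C hC
      have h2 := nonneg_of_mem_C hC
      have h3 := D.e_le_ebar x
      have h4 : ‖vel (D.wlim x)‖ ^ 2 ≤ D.R ^ 2 := pow_le_pow_left₀ (norm_nonneg _) ((norm_vel_le _).trans hx) 2
      constructor <;> simp only [hgl] <;> nlinarith [sq_nonneg D.R]
  have hae := (integral_eq_zero_iff_of_nonneg_ae hgl0 hgli).1 h0
  filter_upwards [hae] with x hx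
  simp only [hgl, Pi.zero_apply] at hx
  linarith

/-- **The limit lies in `𝒦_{e(x)}` a.e.**: `u = v ⊗ v - e/d Id`, `|v|² = e`.
[cite: ChoffrutSzekelyhidi2014, §2, Step 3 and (2.6)] -/
theorem ae_wlim_mem_K : ∀ᵐ x, D.wlim x ∈ K (D.e x) := by
  filter_upwards [D.ae_wlim_mem_C, D.ae_norm_vel_wlim_sq] with x hC hv
  exact mem_K_of_mem_C_of_norm_sq_eq hC hv

end FIterData

end StandingCascade

end Summit.AnomalousDissipation.AnomalousDissipation.Theorems
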